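import Summits.QuantumAdvantage.QuantumAdvantage.Theorems.SosSandwichQueryDilation
import HarnessLib

/-!
# `K_T` is not a bounded dilate of `Q_T` (the address family needs dilation `√T/2`)

Support theorem for route `SosSandwich`, crux `PseudoBoundedAA` (stmt-QuantumAdvantage-15237) and its repaired
homogeneous rung `HomogeneousPBAAT` (stmt-QuantumAdvantage-27399); companion of `SosSandwichQueryDilation`
(route-independent: no `Theses` import — the address family is re-assembled here from the route-independent step
lemmas of `SosSandwichHomogeneousPBAAAddrStep`, exactly as in `SosSandwichHomogeneousPBAARefutation`).

By Kaniewski–Lee–de Wolf (arXiv:1411.7280, Thm. 12) the SOS sandwich class satisfies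
`K_T ⊆ cone(Q_T) ∩ (1 − cone(Q_T))`: every member is `L · (acceptance probability of a T-query algorithm)` for
SOME dilation `L`.  Here:

* `address_dilation_sq_ge` — the address family `P_k` (pseudo-bounded of order `T = 2^{k+1}`, top-homogeneous,
  `Var = 1/4`, every influence `1/T`; the witness of `not_HomogeneousPBAA`) satisfies: if
  `P_k = L · acceptProb(A)` on the cube for a `T`-query algorithm `A`, then `T ≤ 4 L²`.  (A query-complexity
  statement: no `T`-query algorithm accepts with probability exactly `(1 + G_k(x) G_k(x'))/(2L)` unless
  `L ≥ √T/2`.)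
* `exists_pseudoBounded_not_dilate` — hence **`K_T ⊄ [−L, L]·Q_T` for every fixed `L`**: for every real `L`
  there are `T ≥ 1` and a top-homogeneous `P ∈ K_T` with `Var[P] = 1/4` which is not `L'·acceptProb(A)` for any
  `T`-query `A` and any `|L'| ≤ L`.  The `T`-loss of PB-AA on `K_T` (the refutation of the degree-free rung) is
  exactly the statement that `K_T` sticks out of every bounded dilate of the quantum class `Q_T`, on which the
  rung is degree-free (`QueryTopLevel.queryHomogeneousRung`).

Sources: EscuderoGutierrez2023 (arXiv:2304.06713) Cor 1.7; KaniewskiLeeDewolf2015 (arXiv:1411.7280) Thm. 12;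
ODonnell2014 §2.2.
-/

noncomputable section

set_option linter.dupNamespace false

namespace Summit.QuantumAdvantage.QuantumAdvantage.Theorems.SosSandwich.QueryDilation

open Finset MvPolynomial Literature.Computability.Cryptography Literature.Computability.QuantumComplexity
open Literature.Computability.Complexity.LowDegree
open Summit.QuantumAdvantage.QuantumAdvantage.Theorems.SosSandwich.QueryTopLevel
open Summit.QuantumAdvantage.QuantumAdvantage.Theorems.SosSandwich.AddrWitness

variable {N : ℕ}

/-- **The address family needs dilation `√T/2`.**  For every `k` there is a polynomial `P` (the address
polynomial `(1 + G_{k+1}(x)G_{k+1}(x'))/2`, `G` the iterated 4-bit address function) which is pseudo-bounded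
of order `T = 2^{k+1}`, top-homogeneous of order `T`, has `Var = 1/4` and every influence `1/T`, and such that
for every `T`-query quantum algorithm `A` and every real `L` with `P = L · acceptProb_A` on the cube,
`T ≤ 4 L²`.  (Construction re-assembled from the step lemmas of `SosSandwichHomogeneousPBAAAddrStep`, as in
`AddrWitness.exists_counterexample`; the dilation bound is `QueryDilation.dilation_sq_ge`.)
[cite: EscuderoGutierrez2023, Cor 1.7] [cite: KaniewskiLeeDewolf2015, Thm. 12] -/
theorem address_dilation_sq_ge (k : ℕ) : ∃ (N : ℕ) (P : MvPolynomial (Fin N) ℝ),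
    PseudoBounded (2 ^ (k + 1)) P ∧
    (∀ z, ∑ i, (evalBool P z - evalBool P (flipBit i z)) =
      4 * ((2 ^ (k + 1) : ℕ) : ℝ) * (evalBool P z - boolAvg (evalBool P))) ∧
    boolVariance P = 1 / 4 ∧
    (∀ i, influence i P = 1 / (2 : ℝ) ^ (k + 1)) ∧
    ∀ (A : QQueryAlg N), A.queries = 2 ^ (k + 1) → ∀ L : ℝ, (∀ x, evalBool P x = L * A.acceptProb x) →
      (2 : ℝ) ^ (k + 1) ≤ 4 * L ^ 2 := by
  -- the iterated address function `G_k` (adapted from `AddrWitness.exists_addr`)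
  have addr : ∀ k : ℕ, ∃ (n : ℕ) (G : MvPolynomial (Fin n) ℝ),
      G.totalDegree ≤ 2 ^ k ∧
      (∀ x, evalBool G x = 1 ∨ evalBool G x = -1) ∧
      boolAvg (evalBool G) = 0 ∧
      (∀ x, ∑ i, (evalBool G x - evalBool G (flipBit i x)) = 2 * (2 : ℝ) ^ k * evalBool G x) ∧
      (∀ i, boolAvg (fun x => (evalBool G x - evalBool G (flipBit i x)) ^ 2) = 4 / (2 : ℝ) ^ k) := by
    intro k
    induction k with
    | zero => exact ⟨1, 1 - C 2 * X 0, base_props⟩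
    | succ k ih =>
      obtain ⟨n, G, h1, h2, h3, h4, h5⟩ := ih
      refine ⟨(n + n) + (n + n), C (1 / 2) *
        (rename (Fin.castAdd (n + n)) (rename (Fin.castAdd n) G) *
            rename (Fin.natAdd (n + n)) (rename (Fin.castAdd n) G + rename (Fin.natAdd n) G) +
          rename (Fin.castAdd (n + n)) (rename (Fin.natAdd n) G) *
            rename (Fin.natAdd (n + n)) (rename (Fin.castAdd n) G - rename (Fin.natAdd n) G)),
        ?_, ?_, ?_, ?_, ?_⟩
      · refine (totalDegree_stepPoly h1).trans ?_
        rw [pow_succ]; omega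
      · exact step_pm_one (evalBool_stepPoly G) h2
      · exact step_mean (evalBool_stepPoly G) h3
      · intro w
        rw [step_laplacian (evalBool_stepPoly G) h4 w]
        ring
      · intro i
        rw [step_influence (evalBool_stepPoly G) h2 h3 h5 i]
        ring
  -- the counterexample `P = h ⊕ h`, `h = (1 + G)/2` (adapted from `AddrWitness.exists_counterexample`)
  obtain ⟨n, G, h1, h2, h3, h4, h5⟩ := addr (k + 1)
  obtain ⟨H, hH⟩ : ∃ H : MvPolynomial (Fin n) ℝ, H = C (1 / 2) * (1 + G) := ⟨_, rfl⟩
  have hHev : ∀ x, evalBool H x = 1 / 2 * (1 + evalBool G x) := fun x => by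
    rw [hH, evalBool_C_mul', evalBool_add', evalBool_one']
  have hsq : ∀ x, evalBool G x ^ 2 = 1 := sq_eq_one' h2
  have hm : boolAvg (evalBool H) = 1 / 2 := by
    rw [show evalBool H = fun x => 1 / 2 + 1 / 2 * evalBool G x from funext fun x => by rw [hHev x]; ring,
      avg_add, boolAvg_const, avg_const_mul, h3]
    ring
  have hvarH : boolVariance H = 1 / 4 := by
    unfold boolVariance
    rw [hm, show (fun x => (evalBool H x - 1 / 2) ^ 2) = fun _ => (1 / 4 : ℝ) from funext fun x => by
      rw [hHev x]; linear_combination (1 / 4 : ℝ) * hsq x]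
    exact boolAvg_const _
  have hinfH : ∀ i, influence i H = 1 / (2 : ℝ) ^ (k + 1) := fun i => by
    unfold influence
    rw [show (fun x => (evalBool H x - evalBool H (flipBit i x)) ^ 2) =
        fun x => 1 / 4 * (evalBool G x - evalBool G (flipBit i x)) ^ 2 from funext fun x => by
      rw [hHev, hHev]; ring, avg_const_mul, h5 i]
    ring
  have hlapH : ∀ x, ∑ i, (evalBool H x - evalBool H (flipBit i x)) =
      4 * ((2 ^ k : ℕ) : ℝ) * (evalBool H x - boolAvg (evalBool H)) := fun x => by
    rw [hm]
    simp_rw [hHev]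
    rw [show ∑ i, (1 / 2 * (1 + evalBool G x) - 1 / 2 * (1 + evalBool G (flipBit i x))) =
        1 / 2 * ∑ i, (evalBool G x - evalBool G (flipBit i x)) by
      rw [Finset.mul_sum]; exact Finset.sum_congr rfl fun i _ => by ring, h4 x]
    push_cast
    ring
  obtain ⟨-, hlapP⟩ := laplacian_xor H H hlapH hlapH hm hm
  have hT : 2 ^ k + 2 ^ k = 2 ^ (k + 1) := by ring
  rw [hT] at hlapP
  -- the four properties of `P`
  have hPB : PseudoBounded (2 ^ (k + 1)) (rename (Fin.castAdd n) H * rename (Fin.natAdd n) H +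
      (1 - rename (Fin.castAdd n) H) * (1 - rename (Fin.natAdd n) H)) := by
    refine ⟨1, fun _ => C (1 / 2) * (rename (Fin.castAdd n) G + rename (Fin.natAdd n) G),
      fun _ => C (1 / 2) * (rename (Fin.castAdd n) G - rename (Fin.natAdd n) G), fun _ => ⟨?_, ?_⟩, fun w => ?_⟩
    · refine (totalDegree_mul _ _).trans ?_
      rw [totalDegree_C, zero_add]
      exact (totalDegree_add _ _).trans (max_le ((totalDegree_rename_le _ _).trans h1)
        ((totalDegree_rename_le _ _).trans h1))
    · refine (totalDegree_mul _ _).trans ?_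
      rw [totalDegree_C, zero_add]
      exact (totalDegree_sub _ _).trans (max_le ((totalDegree_rename_le _ _).trans h1)
        ((totalDegree_rename_le _ _).trans h1))
    · show evalBool (rename (Fin.castAdd n) H * rename (Fin.natAdd n) H +
          (1 - rename (Fin.castAdd n) H) * (1 - rename (Fin.natAdd n) H)) w =
          ∑ j : Fin 1, evalBool (C (1 / 2) * (rename (Fin.castAdd n) G + rename (Fin.natAdd n) G)) w ^ 2 ∧
        1 - evalBool (rename (Fin.castAdd n) H * rename (Fin.natAdd n) H +
          (1 - rename (Fin.castAdd n) H) * (1 - rename (Fin.natAdd n) H)) w =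
          ∑ j : Fin 1, evalBool (C (1 / 2) * (rename (Fin.castAdd n) G - rename (Fin.natAdd n) G)) w ^ 2
      rw [Fin.sum_univ_one, Fin.sum_univ_one, evalBool_xor, hHev, hHev, evalBool_C_mul', evalBool_add',
        evalBool_C_mul', evalBool_sub', evalBool_rename_castAdd, evalBool_rename_natAdd]
      constructor
      · linear_combination (-1 / 4 : ℝ) * hsq (w ∘ Fin.castAdd n) + (-1 / 4 : ℝ) * hsq (w ∘ Fin.natAdd n)
      · linear_combination (-1 / 4 : ℝ) * hsq (w ∘ Fin.castAdd n) + (-1 / 4 : ℝ) * hsq (w ∘ Fin.natAdd n)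
  have hVar : boolVariance (rename (Fin.castAdd n) H * rename (Fin.natAdd n) H +
      (1 - rename (Fin.castAdd n) H) * (1 - rename (Fin.natAdd n) H)) = 1 / 4 := by
    rw [boolVariance_xor H H hm hm, hvarH]; norm_num
  have hInf : ∀ i, influence i (rename (Fin.castAdd n) H * rename (Fin.natAdd n) H +
      (1 - rename (Fin.castAdd n) H) * (1 - rename (Fin.natAdd n) H)) = 1 / (2 : ℝ) ^ (k + 1) := by
    intro i
    induction i using Fin.addCases with
    | left i => rw [influence_xor_castAdd H H hm i, hinfH, hvarH]; ring
    | right j => rw [influence_xor_natAdd H H hm j, hvarH, hinfH]; ring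
  refine ⟨n + n, _, hPB, hlapP, hVar, hInf, fun A hA L hp => ?_⟩
  -- the dilation bound
  have hT1 : 1 ≤ A.queries := by rw [hA]; exact Nat.one_le_two_pow
  have hhom : ∀ x : Fin (n + n) → Bool, ∑ i : Fin (n + n),
      (evalBool (rename (Fin.castAdd n) H * rename (Fin.natAdd n) H +
        (1 - rename (Fin.castAdd n) H) * (1 - rename (Fin.natAdd n) H)) x -
      evalBool (rename (Fin.castAdd n) H * rename (Fin.natAdd n) H +
        (1 - rename (Fin.castAdd n) H) * (1 - rename (Fin.natAdd n) H)) (Function.update x i (!x i))) =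
      4 * (A.queries : ℝ) * (evalBool (rename (Fin.castAdd n) H * rename (Fin.natAdd n) H +
        (1 - rename (Fin.castAdd n) H) * (1 - rename (Fin.natAdd n) H)) x -
      boolAvg (evalBool (rename (Fin.castAdd n) H * rename (Fin.natAdd n) H +
        (1 - rename (Fin.castAdd n) H) * (1 - rename (Fin.natAdd n) H)))) := fun x => by
    rw [hA]; exact hlapP x
  have h := dilation_sq_ge A hT1 _ L hp hhom (v := 1 / 4) (τ := 1 / (2 : ℝ) ^ (k + 1)) (by norm_num) hVar.ge
    (fun i => (hInf i).le)
  have h2 : (0 : ℝ) < 2 ^ (k + 1) := by positivity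
  rw [show 4 * (1 / 4 : ℝ) ^ 2 = 1 / 4 by norm_num, mul_one_div, le_div_iff₀ h2] at h
  linarith

/-- **`K_T ⊄ [−L, L]·Q_T` for every `L`: the SOS sandwich class is not a bounded dilate of the quantum class.**
For every real `L` there are `T ≥ 1` and a polynomial `P`, pseudo-bounded of order `T`, top-homogeneous of order
`T`, with `Var[P] = 1/4`, such that for every `T`-query quantum algorithm `A` and every `L'` with `|L'| ≤ L` the
identity `P = L' · acceptProb_A` FAILS somewhere on the cube.  (Kaniewski–Lee–de Wolf: every such `P` IS
`L'·acceptProb_A` for some finite `L'`; for the address family `L' ≥ √T/2` is forced.)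
[cite: KaniewskiLeeDewolf2015, Thm. 12] [cite: EscuderoGutierrez2023, Cor 1.7] -/
theorem exists_pseudoBounded_not_dilate (L : ℝ) : ∃ (N T : ℕ) (P : MvPolynomial (Fin N) ℝ),
    1 ≤ T ∧ PseudoBounded T P ∧
    (∀ z, ∑ i, (evalBool P z - evalBool P (flipBit i z)) = 4 * (T : ℝ) * (evalBool P z - boolAvg (evalBool P))) ∧
    boolVariance P = 1 / 4 ∧
    ∀ (A : QQueryAlg N), A.queries = T → ∀ L' : ℝ, |L'| ≤ L → ∃ x, evalBool P x ≠ L' * A.acceptProb x := by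
  obtain ⟨k, hk⟩ := pow_unbounded_of_one_lt (4 * L ^ 2) (by norm_num : (1 : ℝ) < 2)
  obtain ⟨N, P, hPB, hLap, hVar, -, hdil⟩ := address_dilation_sq_ge k
  refine ⟨N, 2 ^ (k + 1), P, Nat.one_le_two_pow, hPB, fun z => ?_, hVar, fun A hA L' hL' => ?_⟩
  · exact hLap z
  · by_contra h
    push Not at h
    have h1 := hdil A hA L' h
    have hL'2 : L' ^ 2 ≤ L ^ 2 := by
      rw [← sq_abs L']
      exact pow_le_pow_left₀ (abs_nonneg _) hL' 2
    have hpow : (2 : ℝ) ^ k ≤ 2 ^ (k + 1) := pow_le_pow_right₀ (by norm_num) (by omega)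
    linarith

end Summit.QuantumAdvantage.QuantumAdvantage.Theorems.SosSandwich.QueryDilation

end
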